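import Literature.NumberTheory.EllipticCurves.Kato2004.DivisibilityInputs
import HarnessLib

/-!
# Kato 2004 (Astérisque 295) §17.13, p. 280 at a height-one prime avoiding `L_p`: the `μ`-bookkeeping
# `length X(E/ℚ_∞)_𝔭 ≤ length 𝐇²_𝔭` and "`μ(𝐇²) = 0 ⟹ μ(X) = 0` when `μ(L_p(E)) = 0`" — THEOREMS over
# the package `Kato2004.DivisibilityInputs` (no definition, no named fact)

Topic `NumberTheory/EllipticCurves`, sub-directory `Kato2004`. Cell `bsd-smallim` (rung K6, class X9),
seat `bsd-smallim-k6-ty`. Companion of `DivisibilityInputs.lean` (the hypothesis structure packaging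
Kato's §17.13 inputs on the pinned pair `(𝐇¹_Γ(T_pW), X(E/ℚ_∞))`, with abstract `P, 𝐇², 𝐇²_loc`) and of
`IwasawaCohomology.lean`. HONEST FRAMING: theorems only; nothing is asserted; these are the LAST two
conversions of the cell's `μ`-transfer (HOME/koly/MU-TRANSFER-PROOF.md §6 (iii), crux `MuTransfer` =
item 19629 of route `SmallImageMuTransfer`) written once in the kernel over the package, so that the
consumer's closer of `stub_x9` is: facts `nonempty_iwasawaH1Data`, `exists_divisibilityInputs`,
`padicLFunction_mem_iwasawaAlgebra` + ONE obligation (the cell's Theorem A, "`Z ⊄ p𝐇¹ ⟹ μ(𝐇²) = 0`",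
KOLY-MEMO Thm. 5.7.1) + `exists_mem_zeta_not_mem_of_mu_eq_zero` (file `DivisibilityInputs`) +
`mu_eq_zero_of_muInvariant_H2_eq_zero_of_certificate` (here). BSD is not advanced by this file.

Printed source of the inequality (Kato, Astérisque 295, §17.13, p. 280 — quoted in full in
`DivisibilityInputs.lean`): "Hence we obtain an exact sequence
`0 → 𝐇¹(T(k))_𝔭/Z(f,T)(k)_𝔭 → Λ_𝔭/(Λ_𝔭 · L_{p-adic,α,ω,γ}(f)) → 𝔛(T*(1−k))_𝔭 → 𝐇²(T(k))_𝔭 → 0`.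
Hence `𝔛(T*(1−k))_𝔭` is a torsion `Λ_𝔭`-module, and
`length(𝔛_𝔭) − length(Λ_𝔭/(L)) = length(𝐇²_𝔭) − length(𝐇¹_𝔭/Z(f,T)_𝔭)`."  At a height-one prime
`𝔭` with `ord_𝔭(L) = 0` this gives `length(𝔛_𝔭) ≤ length(𝐇²_𝔭)`; the proof below uses only what the
package pins (`image_zeta_localized`: `col(loc Z)_𝔭 ∋ s·G₁ ∉ 𝔭`; `col` injective (17.11); exactness
of (17.13.1) at `𝔛`), so it holds for EVERY package, and at `𝔭 = (p)` (prime of height one,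
`IwasawaAlgebra.isPrime_augIdealP_holds`, `height_augIdealP_holds`) it converts `μ(𝐇²) = 0` into
`μ(X(E/ℚ_∞)) = 0` (`D.mu = 0` for the pinned `D : W.SelmerDualData κ γ`).

References: K. Kato, Astérisque 295 (2004), §17.13 (pp. 279–280), Prop. 17.11 (p. 277)
[Kato2004Asterisque]; tree `IwasawaAlgebra*Proofs` (`lengthAt` calculus: `lengthAt_le_add_of_exact`,
`lengthAt_le_of_injective`, `lengthAt_quotient_eq_zero_of_not_le`, `muInvariant_eq_toNat_lengthAt`,
`lengthAt_ne_top_of_isTorsion`).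
-/

noncomputable section

open scoped MatrixGroups ModularForm
open Field CongruenceSubgroup
open Literature.NumberTheory.GaloisRepresentations
open Literature.NumberTheory.EllipticCurves Literature.NumberTheory.EllipticCurves.ModularForms
open Literature.NumberTheory.EllipticCurves.Kato2004.EulerSystemValues

namespace Literature.NumberTheory.EllipticCurves.Kato2004

open Module

/-! ## The `μ`-bookkeeping of §17.13 at a height-one prime avoiding `L_p` (cell use: `𝔭 = (p)`) -/

section Mu

variable {p : ℕ} [Fact p.Prime] {W : WeierstrassCurve ℚ} [W.IsElliptic] [W.IsGloballyMinimal]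
  [ContinuousSMul ℤ_[p] (W.tateModule p)] {N : ℕ} [NeZero N] {f : CuspForm (Gamma0 N) 2}
  {κ : ZpExtension ℚ p} {γ : absoluteGaloisGroup ℚ}
  {I : IwasawaH1Data W p κ γ} {D : W.SelmerDualData κ γ}

omit [NeZero N] in
/-- **Kato's §17.13 bookkeeping at a height-one prime `𝔭` NOT containing (the integral avatar `G₁` of)
`L_p(E,T)`, under `Irr(E[p])`: `length_{Λ_𝔭} X(E/ℚ_∞)_𝔭 ≤ length_{Λ_𝔭} 𝐇²_𝔭`.**  From the package:
`col(loc Z)_𝔭 ∋ s·G₁ ∉ 𝔭` (p. 280 sentence, field `image_zeta_localized`), so `(Λ/col(loc Z))_𝔭 = 0`;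
`P/loc Z ↪ Λ/col(loc Z)` (`col` injective, 17.11); and `P/loc Z → X → 𝐇²` is exact at `X` ((17.13.1)
with `loc Z ⊆ loc 𝐇¹ = ker(P → X)`), whence `length X_𝔭 ≤ length (P/loc Z)_𝔭 + length 𝐇²_𝔭 = length 𝐇²_𝔭`
— the inequality of p. 280 "`length(𝔛_𝔭) − length(Λ_𝔭/(L)) = length(𝐇²_𝔭) − length(𝐇¹_𝔭/Z(f,T)_𝔭)`"
read at a prime where `ord_𝔭(L) = 0`, keeping only what the package pins.  At `𝔭 = (p)` this is the
cell's conversion "`μ(𝐇²) = 0 ⟹ μ(X(E/ℚ_∞)) = 0` when `μ(L_p(E)) = 0`" (HOME/koly/MU-TRANSFER-PROOF.md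
§6 (iii)). [cite: Kato2004Asterisque, §17.13 (p. 280) and Prop. 17.11 (p. 277)] -/
theorem lengthAt_X_le_lengthAt_H2 (K : DivisibilityInputs W p f κ γ I D)
    (hirr : W.HasIrreducibleModPGaloisRep p) {G₁ : IwasawaAlgebra p}
    (hG₁ : iwasawaToPowerSeries p G₁ = padicLFunction f (unitRoot W p : ℚ_[p]))
    (𝔭 : PrimeSpectrum (IwasawaAlgebra p)) (h𝔭 : 𝔭.asIdeal.height = 1) (hG𝔭 : G₁ ∉ 𝔭.asIdeal) :
    lengthAt (IwasawaAlgebra p) D.X 𝔭 ≤ lengthAt (IwasawaAlgebra p) K.H2 𝔭 := by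
  obtain ⟨s, hs, hsG, -⟩ := K.image_zeta_localized hirr G₁ hG₁ 𝔭 h𝔭
  -- the image ideal `M = col(loc Z)` is not contained in `𝔭`
  set LZ : Submodule (IwasawaAlgebra p) K.P := Submodule.map K.loc K.Z with hLZ
  set M : Ideal (IwasawaAlgebra p) := Submodule.map K.col LZ with hM
  have hM_eq : Submodule.map (K.col ∘ₗ K.loc) K.Z = M := by
    rw [hM, hLZ, Submodule.map_comp]
  have hsGM : s * G₁ ∈ M := hM_eq ▸ hsG
  have hnot : ¬ M ≤ 𝔭.asIdeal := fun hle ↦ by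
    rcases 𝔭.isPrime.mem_or_mem (hle hsGM) with h | h
    · exact hs h
    · exact hG𝔭 h
  have hΛM : lengthAt (IwasawaAlgebra p) (IwasawaAlgebra p ⧸ M) 𝔭 = 0 :=
    lengthAt_quotient_eq_zero_of_not_le hnot
  -- `P / loc Z ↪ Λ / M`
  have hPLZ : lengthAt (IwasawaAlgebra p) (K.P ⧸ LZ) 𝔭 = 0 := by
    refine le_antisymm ?_ bot_le
    rw [← hΛM]
    refine lengthAt_le_of_injective (Submodule.mapQ LZ M K.col fun y hy ↦ ⟨y, hy, rfl⟩) ?_ 𝔭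
    rw [← LinearMap.ker_eq_bot, Submodule.ker_mapQ, hM,
      Submodule.comap_map_eq_of_injective K.col_injective, Submodule.mkQ_map_self]
  -- `P / loc Z → X → H2` exact at `X`
  have hle : LZ ≤ LinearMap.ker K.toX := by
    rintro _ ⟨z, -, rfl⟩
    exact (K.exact_P (K.loc z)).mpr ⟨z, rfl⟩
  let f' : (K.P ⧸ LZ) →ₗ[IwasawaAlgebra p] D.X := LZ.liftQ K.toX hle
  have hf' : Function.Exact f' K.δ := by
    rw [LinearMap.exact_iff]
    rw [Submodule.range_liftQ]
    exact LinearMap.exact_iff.mp K.exact_X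
  calc lengthAt (IwasawaAlgebra p) D.X 𝔭
      ≤ lengthAt (IwasawaAlgebra p) (K.P ⧸ LZ) 𝔭 + lengthAt (IwasawaAlgebra p) K.H2 𝔭 :=
        lengthAt_le_add_of_exact f' K.δ hf' 𝔭
    _ = lengthAt (IwasawaAlgebra p) K.H2 𝔭 := by rw [hPLZ, zero_add]

omit [NeZero N] in
/-- **`μ(𝐇²) = 0 ⟹ μ(X(E/ℚ_∞)) = 0` when `μ(L_p(E)) = 0` and `E[p]` is irreducible** — the last
conversion of the cell's `μ`-transfer (MU-TRANSFER-PROOF.md §6 (iii); Kato §17.13 p. 280 at `𝔭 = (p)`),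
in the tree's currencies: `G₁ ∈ Λ` with `ι G₁ = L_p(E,T)` and `G₁ ∉ (p)`; `μ` of the package's `𝐇²`
as `muInvariant`; conclusion `D.mu = 0` for the PINNED dual Selmer datum. The hypothesis `μ(𝐇²) = 0`
is the cell's Theorem A (an obligation of the consumer, not asserted here).
[cite: Kato2004Asterisque, §17.13 (p. 280)] -/
theorem mu_eq_zero_of_muInvariant_H2_eq_zero (K : DivisibilityInputs W p f κ γ I D)
    (hirr : W.HasIrreducibleModPGaloisRep p) {G₁ : IwasawaAlgebra p}
    (hG₁ : iwasawaToPowerSeries p G₁ = padicLFunction f (unitRoot W p : ℚ_[p]))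
    (hμL : G₁ ∉ IwasawaAlgebra.augIdealP p) (hH2 : muInvariant p K.H2 = 0) : D.mu = 0 := by
  let 𝔭 : PrimeSpectrum (IwasawaAlgebra p) :=
    ⟨IwasawaAlgebra.augIdealP p, IwasawaAlgebra.isPrime_augIdealP_holds p⟩
  haveI : Module.Finite (IwasawaAlgebra p) K.H2 := K.finite_H2
  -- `μ(𝐇²) = 0` means `length_{(p)} 𝐇² = 0` (finite for a f.g. torsion module)
  have hH2' : lengthAt (IwasawaAlgebra p) K.H2 𝔭 = 0 := by
    have hne : lengthAt (IwasawaAlgebra p) K.H2 𝔭 ≠ ⊤ :=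
      lengthAt_ne_top_of_isTorsion p K.H2 K.isTorsion_H2 𝔭 rfl
    have hnat := muInvariant_eq_toNat_lengthAt p K.H2 𝔭 rfl
    rw [hH2] at hnat
    rcases ENat.toNat_eq_zero.mp hnat.symm with h | h
    · exact h
    · exact absurd h hne
  have hX : lengthAt (IwasawaAlgebra p) D.X 𝔭 = 0 :=
    le_antisymm ((lengthAt_X_le_lengthAt_H2 K hirr hG₁ 𝔭
      (by exact IwasawaAlgebra.height_augIdealP_holds p) hμL).trans hH2'.le) bot_le
  change muInvariant p D.X = 0
  rw [muInvariant_eq_toNat_lengthAt p D.X 𝔭 rfl, hX]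
  rfl

omit [NeZero N] in
/-- The same, with `μ(L_p(E)) = 0` in the certificate currency of `Rank1Residual.KatoMuTransfer`
(`∃ n, ‖coeff_n L_p(f, α)‖ = 1`) and `L_p ∈ ι(Λ)` (Greenberg–Vatsal 2000 Prop. 3.7 under `Irr(E[p])`,
tree fact `padicLFunction_mem_iwasawaAlgebra`) as the binder `hG₁`.
[cite: Kato2004Asterisque, §17.13 (p. 280)] -/
theorem mu_eq_zero_of_muInvariant_H2_eq_zero_of_certificate (K : DivisibilityInputs W p f κ γ I D)
    (hirr : W.HasIrreducibleModPGaloisRep p) {G₁ : IwasawaAlgebra p}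
    (hG₁ : iwasawaToPowerSeries p G₁ = padicLFunction f (unitRoot W p : ℚ_[p]))
    (hcert : ∃ n : ℕ, ‖PowerSeries.coeff n (padicLFunction f (unitRoot W p : ℚ_[p]))‖ = 1)
    (hH2 : muInvariant p K.H2 = 0) : D.mu = 0 :=
  mu_eq_zero_of_muInvariant_H2_eq_zero K hirr hG₁ (not_mem_augIdealP_of_norm_coeff_eq_one hG₁ hcert)
    hH2

end Mu

end Literature.NumberTheory.EllipticCurves.Kato2004

end
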